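/-
Copyright (c) 2026 the pub-hodgecm-mathlib formalisation cell (harness21).  Prover seat hodgecm-mathlib-LH10-p02 (g12); G-rows dealer ∕ reader F0P3a-p09 (g13) (LEAD F0P3a-plan
(g15) T14-69 (1), rule-20 brick); CENSUS «EP-G» v1 §5 ∕ G-ROW LEDGER v2 row (G1c) «SPLIT-TORUS-KIT-3»; 2026-09-02.  Rank-3 twin of ★ A-p06 (g27)'s `UnitaryGroupSplitTorusRankOne`.
-/
import Literature.NumberTheory.Automorphic.UnitaryGroupSplitTorusRankOne           -- ★ (S4c) A-p06 (g27): rank-2 template; brings ★ (S4b-engine) `CompactCoreCentralizerDiagonalTranslation`, `IwasawaDecompositionGL`, `CompactCoreCentralizerUnitary`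
import HarnessLib

/-!
# The split torus of `U(σ, H)` for an ANTIDIAGONAL-shaped hermitian 3-space: diagonal unitary elements are `diag(a, b, (σa)⁻¹)` with `b·σb = 1`, rank one in valuation,
# generator `τ = diag(ϖ⁻¹, 1, ϖ)` (Rogawski (1990), §1.10 p. 9, §3.6 p. 31, §4.3 p. 43; Tits (1979), §3.9) — the rank-3 twin of ★ `UnitaryGroupSplitTorusRankOne`

Topic `NumberTheory/Automorphic`; namespace `Literature.NumberTheory.Automorphic.UnitaryGroup`.  KERNEL mathematics only: theorems, no definition, no named fact, no instance,
no `sorry`.  Cell `pub/hodgecm-mathlib`, crux H413 = `stmt-HodgeConjecture-24833` (`--supports` lane, helper); LEAD F0P3a-plan (g15) T14-69 (1) rule-20 brick; CENSUS «EP-G» v1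
(F0P3a-p09 (g12)) §5, G-ROW LEDGER v2 (F0P3a-p09 (g13)) row **(G1c) «SPLIT-TORUS-KIT-3»**, part (T2) = the `hgen`∕`hfree` binders of ★ (S4a)
`classOrbitalIntegral_indicator_complex_eq_mul_natCard_quotient_zpowers` for the `U(3)` split torus, in the shape `eU τ = diagonal ![ϖ⁻¹, 1, ϖ]` consumed by LH6-p03 (g8)'s (G1)
coset side `UnitaryLatticeTreePeriodRelation` (P2 v3 head `hτm`).  Seat LH10-p02 (g12).  HONEST LABEL: count-neutral (closes no node; EP-G instances only at t1′); HC_CM is proved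
only modulo the 7 printed citations (2 remaining named inputs hLiu418 = stmt-HodgeConjecture-24832, h413 = stmt-HodgeConjecture-24833) until rung 0 closes; this file discharges
no named fact.

For a matrix `H ∈ M₃(E)` with `H₀₂ ≠ 0`, `H₁₁ ≠ 0` (and, for the membership converse, `Hᵢⱼ = 0` off the antidiagonal) — the quasi-split form `Φ₃ = antidiag(1,1,1)` read at a
place, and its rescalings:
* §1 (any field ∕ valued field) `map_apply_zero_mul_apply_two_eq_one_of_mem_unitaryGroupOfForm` (`σ(e₀)·e₂ = 1`), `map_apply_one_mul_apply_one_eq_one_of_mem_unitaryGroupOfForm`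
  (`σ(e₁)·e₁ = 1`) for a DIAGONAL `diag(e) ∈ U(σ, H)`; `mem_unitaryGroupOfForm_of_eq_diagonal_three` (converse); `valuation_apply_two_eq_inv`, `valuation_apply_one_eq_one`
  (`|e₂| = |e₀|⁻¹`, `|e₁| = 1` for valuation-preserving `σ`); `exists_valuation_apply_eq_zpow_three` — RANK ONE: with a uniformizing `ϖ` (`𝒪` a DVR) and a diagonal
  `τ = diag(t) ∈ U(σ, H)` with `|t₀| = |ϖ|⁻¹`, every diagonal `g = diag(e) ∈ U(σ, H)` has `|eᵢ| = |tᵢ| ^ n` (`i = 0, 1, 2`) for one `n ∈ ℤ`.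
* §2 the carrier `U(J)(F_v)` at a NON-SPLIT place (`φ = subtype ∘ localNonsplitEquiv`, ★ `isClosedEmbedding_subtype_comp_localNonsplitEquiv`; ★ (S4b-engine)
  `eq_zero_of_zpow_mem_compactCore_centralizer` ∕ `exists_mul_zpow_inv_mem_compactCore_centralizer` called directly — no rank-3 copies of ★ (S4c) §2):
  **`exists_splitTorus_generator_local_of_nonsplit_three`** — for `σ_w ϖ = ϖ` the generator `τ := e⁻¹ diag(ϖ⁻¹, 1, ϖ) ∈ Z(γ)` with (gen) and (free).
Consumer: `G = Gqs L v = U(Φ₃)(L⁺_v)` at a non-split `v` of a CM field, `J = Φ₃` (`(Φ₃)_w = antidiag(1,1,1)`), `ϖ = ι_w ϖ_v`; the (G1) assembly of LH6-p03 and the (G3) EP-G glue.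

## References
* [Rogawski1990] J. D. Rogawski, *Automorphic Representations of Unitary Groups in Three Variables*, Ann. of Math. Stud. 123 (1990), §1.10 p. 9, §3.6 p. 31, §4.3 p. 43.
* [Tits1979] J. Tits, *Reductive groups over local fields*, PSPM 33.1 (1979), §3.9 (`Z = A · Z_c` for the split component of a torus).
* [Serre1980Trees] J.-P. Serre, *Trees* (1980), II.1.1, II.1.3.
-/

set_option autoImplicit false

noncomputable section

open Matrix NumberField IsDedekindDomain Topology
open scoped MatrixGroups ValuativeRel
open ValuativeRel

namespace Literature.NumberTheory.Automorphic.UnitaryGroup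

open Literature.NumberTheory.Automorphic

/-! ## §1 Diagonal elements of `U(σ, H)`, `H` antidiagonal-shaped of size 3 -/

section Field

variable {E : Type*} [Field E] (σ : E →+* E) {H : Matrix (Fin 3) (Fin 3) E}

/-- The Gram matrix of `H` in a diagonal frame: `((σ·diag e)ᵀ H (diag e))ᵢⱼ = σ(eᵢ) Hᵢⱼ eⱼ`. [cite: Rogawski1990, §1.10 p. 9] -/
theorem map_diagonal_transpose_mul_mul_diagonal_apply_three (e : Fin 3 → E) (i j : Fin 3) :
    (((diagonal e).map σ)ᵀ * H * diagonal e) i j = σ (e i) * H i j * e j := by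
  rw [diagonal_map (map_zero σ), diagonal_transpose, mul_diagonal, diagonal_mul]

/-- **A diagonal element `diag(e₀, e₁, e₂)` of `U(σ, H)` (`H₀₂ ≠ 0`) has `σ(e₀) · e₂ = 1`.** [cite: Rogawski1990, §1.10 p. 9; §3.6 p. 31] -/
theorem map_apply_zero_mul_apply_two_eq_one_of_mem_unitaryGroupOfForm (hH₀₂ : H 0 2 ≠ 0) {g : GL (Fin 3) E} (hg : g ∈ unitaryGroupOfForm σ H) {e : Fin 3 → E}
    (hge : (g : Matrix (Fin 3) (Fin 3) E) = diagonal e) : σ (e 0) * e 2 = 1 := by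
  have h := congrFun (congrFun (mem_unitaryGroupOfForm_iff.1 hg) 0) 2
  rw [hge, map_diagonal_transpose_mul_mul_diagonal_apply_three] at h
  have h2 : (σ (e 0) * e 2 - 1) * H 0 2 = 0 := by linear_combination h
  exact sub_eq_zero.1 ((mul_eq_zero.1 h2).resolve_right hH₀₂)

/-- … `σ(e₁) · e₁ = 1` (`H₁₁ ≠ 0`). [cite: Rogawski1990, §1.10 p. 9; §3.6 p. 31] -/
theorem map_apply_one_mul_apply_one_eq_one_of_mem_unitaryGroupOfForm (hH₁₁ : H 1 1 ≠ 0) {g : GL (Fin 3) E} (hg : g ∈ unitaryGroupOfForm σ H) {e : Fin 3 → E}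
    (hge : (g : Matrix (Fin 3) (Fin 3) E) = diagonal e) : σ (e 1) * e 1 = 1 := by
  have h := congrFun (congrFun (mem_unitaryGroupOfForm_iff.1 hg) 1) 1
  rw [hge, map_diagonal_transpose_mul_mul_diagonal_apply_three] at h
  have h2 : (σ (e 1) * e 1 - 1) * H 1 1 = 0 := by linear_combination h
  exact sub_eq_zero.1 ((mul_eq_zero.1 h2).resolve_right hH₁₁)

/-- … and `σ(e₂) · e₀ = 1` (`H₂₀ ≠ 0`). [cite: Rogawski1990, §1.10 p. 9; §3.6 p. 31] -/
theorem map_apply_two_mul_apply_zero_eq_one_of_mem_unitaryGroupOfForm (hH₂₀ : H 2 0 ≠ 0) {g : GL (Fin 3) E} (hg : g ∈ unitaryGroupOfForm σ H) {e : Fin 3 → E}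
    (hge : (g : Matrix (Fin 3) (Fin 3) E) = diagonal e) : σ (e 2) * e 0 = 1 := by
  have h := congrFun (congrFun (mem_unitaryGroupOfForm_iff.1 hg) 2) 0
  rw [hge, map_diagonal_transpose_mul_mul_diagonal_apply_three] at h
  have h2 : (σ (e 2) * e 0 - 1) * H 2 0 = 0 := by linear_combination h
  exact sub_eq_zero.1 ((mul_eq_zero.1 h2).resolve_right hH₂₀)

/-- **Conversely, `diag(e₀, e₁, e₂) ∈ U(σ, H)` when `σ(e₀) e₂ = 1`, `σ(e₁) e₁ = 1`, `σ(e₂) e₀ = 1`** (`H` vanishing off the antidiagonal; e.g. `τ = diag(ϖ⁻¹, 1, ϖ)` for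
`σ ϖ = ϖ`). [cite: Rogawski1990, §1.10 p. 9; §3.6 p. 31] -/
theorem mem_unitaryGroupOfForm_of_eq_diagonal_three (hH : ∀ i j : Fin 3, j ≠ Fin.rev i → H i j = 0) {g : GL (Fin 3) E} {e : Fin 3 → E}
    (hge : (g : Matrix (Fin 3) (Fin 3) E) = diagonal e) (h₀ : σ (e 0) * e 2 = 1) (h₁ : σ (e 1) * e 1 = 1) (h₂ : σ (e 2) * e 0 = 1) :
    g ∈ unitaryGroupOfForm σ H := by
  rw [mem_unitaryGroupOfForm_iff, hge]
  ext i j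
  rw [map_diagonal_transpose_mul_mul_diagonal_apply_three]
  by_cases hij : j = Fin.rev i
  · subst hij
    fin_cases i
    · calc σ (e 0) * H 0 (Fin.rev 0) * e (Fin.rev 0) = σ (e 0) * e 2 * H 0 2 := by
            rw [show Fin.rev (0 : Fin 3) = 2 from rfl]; ring
        _ = H 0 (Fin.rev 0) := by rw [h₀, one_mul]; rfl
    · calc σ (e 1) * H 1 (Fin.rev 1) * e (Fin.rev 1) = σ (e 1) * e 1 * H 1 1 := by
            rw [show Fin.rev (1 : Fin 3) = 1 from rfl]; ring
        _ = H 1 (Fin.rev 1) := by rw [h₁, one_mul]; rfl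
    · calc σ (e 2) * H 2 (Fin.rev 2) * e (Fin.rev 2) = σ (e 2) * e 0 * H 2 0 := by
            rw [show Fin.rev (2 : Fin 3) = 0 from rfl]; ring
        _ = H 2 (Fin.rev 2) := by rw [h₂, one_mul]; rfl
  · rw [hH i j hij, mul_zero, zero_mul]

variable [ValuativeRel E] (hσv : ∀ x : E, valuation E (σ x) = valuation E x)

include hσv in
/-- **`|e₂| = |e₀|⁻¹` for a diagonal `diag(e) ∈ U(σ, H)`**, `σ` valuation-preserving, `H₀₂ ≠ 0`. [cite: Rogawski1990, §3.6 p. 31] [cite: Tits1979, §3.9] -/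
theorem valuation_apply_two_eq_inv (hH₀₂ : H 0 2 ≠ 0) {g : GL (Fin 3) E} (hg : g ∈ unitaryGroupOfForm σ H) {e : Fin 3 → E}
    (hge : (g : Matrix (Fin 3) (Fin 3) E) = diagonal e) : valuation E (e 2) = (valuation E (e 0))⁻¹ := by
  have h := congrArg (valuation E) (map_apply_zero_mul_apply_two_eq_one_of_mem_unitaryGroupOfForm σ hH₀₂ hg hge)
  rw [map_mul, map_one, hσv] at h
  exact eq_inv_of_mul_eq_one_right h

include hσv in
/-- **`|e₁| = 1` for a diagonal `diag(e) ∈ U(σ, H)`**, `σ` valuation-preserving, `H₁₁ ≠ 0` (`|e₁|² = 1` in the linearly ordered value group).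
[cite: Rogawski1990, §3.6 p. 31] [cite: Tits1979, §3.9] -/
theorem valuation_apply_one_eq_one (hH₁₁ : H 1 1 ≠ 0) {g : GL (Fin 3) E} (hg : g ∈ unitaryGroupOfForm σ H) {e : Fin 3 → E}
    (hge : (g : Matrix (Fin 3) (Fin 3) E) = diagonal e) : valuation E (e 1) = 1 := by
  have h := congrArg (valuation E) (map_apply_one_mul_apply_one_eq_one_of_mem_unitaryGroupOfForm σ hH₁₁ hg hge)
  rw [map_mul, map_one, hσv, ← pow_two] at h
  exact (pow_eq_one_iff.1 h).resolve_right two_ne_zero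

include hσv in
/-- **RANK ONE IN VALUATION**: if `𝒪` is a DVR with uniformizing element `ϖ`, `τ = diag(t) ∈ U(σ, H)` has `|t₀| = |ϖ|⁻¹`, and `g = diag(e) ∈ U(σ, H)`, then `|eᵢ| = |tᵢ| ^ n`
(`i = 0, 1, 2`) for one `n ∈ ℤ` (`|e₀| = |ϖ|^m`, `n = −m`; `|e₁| = |t₁| = 1`; `|e₂| = |e₀|⁻¹`, `|t₂| = |t₀|⁻¹`). [cite: Tits1979, §3.9] [cite: Rogawski1990, §4.3 p. 43] -/
theorem exists_valuation_apply_eq_zpow_three [IsDiscreteValuationRing 𝒪[E]] {ϖ : E} (hϖ : IsUniformizingElement ϖ) (hH₀₂ : H 0 2 ≠ 0) (hH₁₁ : H 1 1 ≠ 0)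
    {τ : GL (Fin 3) E} (hτ : τ ∈ unitaryGroupOfForm σ H) {t : Fin 3 → E} (hτt : (τ : Matrix (Fin 3) (Fin 3) E) = diagonal t)
    (ht₀ : valuation E (t 0) = (valuation E ϖ)⁻¹)
    {g : GL (Fin 3) E} (hg : g ∈ unitaryGroupOfForm σ H) {e : Fin 3 → E} (hge : (g : Matrix (Fin 3) (Fin 3) E) = diagonal e) :
    ∃ n : ℤ, ∀ i : Fin 3, valuation E (e i) = valuation E (t i) ^ n := by
  -- `e₀ ≠ 0` (`det g = e₀ e₁ e₂ ≠ 0`)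
  have he₀ : e 0 ≠ 0 := by
    have hdet : (g : Matrix (Fin 3) (Fin 3) E).det ≠ 0 := (Matrix.isUnits_det_units g).ne_zero
    rw [hge, det_diagonal, Fin.prod_univ_three] at hdet
    exact left_ne_zero_of_mul (left_ne_zero_of_mul hdet)
  obtain ⟨m, u, hu, hm⟩ := exists_eq_zpow_mul_of_ne_zero hϖ he₀
  have h0 : valuation E (e 0) = valuation E ϖ ^ m := by rw [hm, map_mul, map_zpow₀, hu, mul_one]
  refine ⟨-m, ?_⟩
  rw [Fin.forall_fin_succ, Fin.forall_fin_two]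
  refine ⟨?_, ?_, ?_⟩
  · rw [h0, ht₀, _root_.inv_zpow', neg_neg]
  · show valuation E (e 1) = valuation E (t 1) ^ (-m)
    rw [valuation_apply_one_eq_one σ hσv hH₁₁ hg hge, valuation_apply_one_eq_one σ hσv hH₁₁ hτ hτt, _root_.one_zpow]
  · show valuation E (e 2) = valuation E (t 2) ^ (-m)
    rw [valuation_apply_two_eq_inv σ hσv hH₀₂ hg hge, valuation_apply_two_eq_inv σ hσv hH₀₂ hτ hτt, h0, ht₀, inv_inv, _root_.zpow_neg]

end Field

/-! ## §2 The CM ∕ quadratic carrier `U(J)(F_v)` at a NON-SPLIT place: the generator `τ = e⁻¹ diag(ϖ⁻¹, 1, ϖ)`, (gen) and (free) by the ★ engine -/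

section Carrier

open Literature.NumberTheory.GaloisRepresentations

variable {F E : Type} [Field F] [NumberField F] [Field E] [NumberField E] [Algebra F E] [Algebra.IsQuadraticExtension F E]
  (c : E ≃ₐ[F] E) (J : Matrix (Fin 3) (Fin 3) E) {v : HeightOneSpectrum (𝓞 F)} (hc : c ≠ 1) (w : PlacesOver E v) (hw : c • w.1 = w.1)

/-- **THE SPLIT-TORUS GENERATOR ON THE CARRIER `U(J)(F_v)`, `v` non-split, `J_w` antidiagonal-shaped of size 3** (`(J_w)ᵢⱼ = 0` off the antidiagonal, `(J_w)₀₂ ≠ 0 ≠ (J_w)₁₁`;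
e.g. `J = Φ₃`): if the one-place image `e γ ∈ U(σ_w, J_w)(E_w)` of `γ` is a REGULAR diagonal matrix, then for every uniformizing `ϖ` of `E_w` FIXED by `σ_w` (`𝒪_w` a DVR; e.g.
`ϖ = ι_w ϖ_v` at an unramified `v`) the element `τ := e⁻¹ diag(ϖ⁻¹, 1, ϖ)` lies in `Z(γ)` and satisfies (gen) `∀ c ∈ Z(γ), ∃ n, c·τ^{−n} ∈ compactCore Z(γ)` and (free)
`τ^n ∈ compactCore Z(γ) → n = 0` — the hypotheses `hgen`, `hfree` of ★ (S4a) `classOrbitalIntegral_indicator_complex_eq_mul_natCard_quotient_zpowers` (§2 along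
`φ = subtype ∘ e`, ★ `isClosedEmbedding_subtype_comp_localNonsplitEquiv`), with `e τ = diagonal ![ϖ⁻¹, 1, ϖ]` the `hτm` binder of LH6-p03's (G1) period relation.
[cite: Tits1979, §3.9] [cite: Rogawski1990, §3.6 p. 31; §4.3 p. 43] [cite: Serre1980Trees, II.1.3] -/
theorem exists_splitTorus_generator_local_of_nonsplit_three
    (hJ : ∀ i j : Fin 3, j ≠ Fin.rev i → placeForm J w.1 i j = 0) (hJ₀₂ : placeForm J w.1 0 2 ≠ 0) (hJ₁₁ : placeForm J w.1 1 1 ≠ 0)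
    [IsDiscreteValuationRing 𝒪[w.1.adicCompletion E]] {ϖ : w.1.adicCompletion E} (hϖ : IsUniformizingElement ϖ)
    (hσϖ : galAdicCompletionMap (L := E) c hw ϖ = ϖ)
    {γ : «local» E c 3 J v} {d : Fin 3 → w.1.adicCompletion E}
    (hγ : (((localNonsplitEquiv c J hc w hw γ : unitaryGroupOfForm (galAdicCompletionMap (L := E) c hw) (placeForm J w.1)) :
      GL (Fin 3) (w.1.adicCompletion E)) : Matrix (Fin 3) (Fin 3) (w.1.adicCompletion E)) = diagonal d) (hd : ∀ i j, i ≠ j → IsUnit (d i - d j)) :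
    ∃ τ : Subgroup.centralizer ({γ} : Set («local» E c 3 J v)),
      (((localNonsplitEquiv c J hc w hw (τ : «local» E c 3 J v) : unitaryGroupOfForm (galAdicCompletionMap (L := E) c hw) (placeForm J w.1)) :
          GL (Fin 3) (w.1.adicCompletion E)) : Matrix (Fin 3) (Fin 3) (w.1.adicCompletion E)) = diagonal ![ϖ⁻¹, 1, ϖ] ∧
      (∀ c' : Subgroup.centralizer ({γ} : Set («local» E c 3 J v)), ∃ n : ℤ, c' * (τ ^ n)⁻¹ ∈ compactCore (Subgroup.centralizer ({γ} : Set («local» E c 3 J v)))) ∧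
      (∀ n : ℤ, τ ^ n ∈ compactCore (Subgroup.centralizer ({γ} : Set («local» E c 3 J v))) → n = 0) := by
  set σ := galAdicCompletionMap (L := E) c hw with hσdef
  set e := localNonsplitEquiv c J hc w hw with hedef
  have hσv : ∀ x : w.1.adicCompletion E, valuation (w.1.adicCompletion E) (σ x) = valuation (w.1.adicCompletion E) x :=
    fun x => valuation_galAdicCompletionMap_eq c v w hw x
  have hϖ0 : ϖ ≠ 0 := hϖ.ne_zero
  -- the diagonal unitary `τ_U = diag(ϖ⁻¹, 1, ϖ)`
  have ht : ∀ i, (![ϖ⁻¹, 1, ϖ] : Fin 3 → w.1.adicCompletion E) i ≠ 0 := by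
    intro i
    fin_cases i
    · exact inv_ne_zero hϖ0
    · exact one_ne_zero
    · exact hϖ0
  set τU : GL (Fin 3) (w.1.adicCompletion E) := glDiagonal 3 (w.1.adicCompletion E) fun i => Units.mk0 ((![ϖ⁻¹, 1, ϖ] : Fin 3 → w.1.adicCompletion E) i) (ht i)
    with hτUdef
  have hτUt : (τU : Matrix (Fin 3) (Fin 3) (w.1.adicCompletion E)) = diagonal ![ϖ⁻¹, 1, ϖ] := by rw [hτUdef, coe_glDiagonal]; rfl
  have hτUmem : τU ∈ unitaryGroupOfForm σ (placeForm J w.1) := by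
    refine mem_unitaryGroupOfForm_of_eq_diagonal_three σ hJ hτUt ?_ ?_ ?_
    · show σ ϖ⁻¹ * ϖ = 1
      rw [map_inv₀, hσϖ, inv_mul_cancel₀ hϖ0]
    · show σ 1 * 1 = 1
      rw [map_one, mul_one]
    · show σ ϖ * ϖ⁻¹ = 1
      rw [hσϖ, mul_inv_cancel₀ hϖ0]
  -- pull it back to the carrier
  set τG : «local» E c 3 J v := e.symm ⟨τU, hτUmem⟩ with hτGdef
  have heτ : e τG = ⟨τU, hτUmem⟩ := e.apply_symm_apply _
  have hτZ : τG ∈ Subgroup.centralizer ({γ} : Set («local» E c 3 J v)) := by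
    rw [Subgroup.mem_centralizer_singleton_iff]
    apply e.injective
    rw [map_mul, map_mul, heτ]
    apply Subtype.ext
    apply Units.ext
    change (τU : Matrix (Fin 3) (Fin 3) (w.1.adicCompletion E)) * ((e γ : unitaryGroupOfForm σ (placeForm J w.1)) : GL (Fin 3) (w.1.adicCompletion E)) =
      (((e γ : unitaryGroupOfForm σ (placeForm J w.1)) : GL (Fin 3) (w.1.adicCompletion E)) : Matrix (Fin 3) (Fin 3) (w.1.adicCompletion E)) * τU
    rw [hτUt, hγ, diagonal_mul_diagonal, diagonal_mul_diagonal]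
    congr 1
    funext i
    exact mul_comm _ _
  -- the closed embedding `φ = subtype ∘ e`
  have hφ := isClosedEmbedding_subtype_comp_localNonsplitEquiv c 3 J hc w hw
  have hφU : ∀ g : «local» E c 3 J v,
      ((unitaryGroupOfForm σ (placeForm J w.1)).subtype.comp e.toMonoidHom) g ∈ unitaryGroupOfForm σ (placeForm J w.1) := fun g => (e g).2
  have hγ' : ((((unitaryGroupOfForm σ (placeForm J w.1)).subtype.comp e.toMonoidHom) γ : GL (Fin 3) (w.1.adicCompletion E)) :
      Matrix (Fin 3) (Fin 3) (w.1.adicCompletion E)) = diagonal d := hγ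
  have hτ₀ : valuation (w.1.adicCompletion E) (((((unitaryGroupOfForm σ (placeForm J w.1)).subtype.comp e.toMonoidHom)
      ((⟨τG, hτZ⟩ : Subgroup.centralizer ({γ} : Set («local» E c 3 J v))) : «local» E c 3 J v) : GL (Fin 3) (w.1.adicCompletion E)) :
        Matrix (Fin 3) (Fin 3) (w.1.adicCompletion E)) 0 0) = (valuation (w.1.adicCompletion E) ϖ)⁻¹ := by
    change valuation (w.1.adicCompletion E) ((((e τG : unitaryGroupOfForm σ (placeForm J w.1)) : GL (Fin 3) (w.1.adicCompletion E)) :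
      Matrix (Fin 3) (Fin 3) (w.1.adicCompletion E)) 0 0) = (valuation (w.1.adicCompletion E) ϖ)⁻¹
    rw [heτ]
    change valuation (w.1.adicCompletion E) ((τU : Matrix (Fin 3) (Fin 3) (w.1.adicCompletion E)) 0 0) = (valuation (w.1.adicCompletion E) ϖ)⁻¹
    rw [hτUt, diagonal_apply_eq]
    exact map_inv₀ _ _
  refine ⟨⟨τG, hτZ⟩, ?_, fun c' => ?_, fun n hn => ?_⟩
  · change (((e τG : unitaryGroupOfForm σ (placeForm J w.1)) : GL (Fin 3) (w.1.adicCompletion E)) : Matrix (Fin 3) (Fin 3) (w.1.adicCompletion E)) =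
      diagonal ![ϖ⁻¹, 1, ϖ]
    rw [heτ]
    exact hτUt
  · refine exists_mul_zpow_inv_mem_compactCore_centralizer w.1 _ hγ' hd hφ ⟨τG, hτZ⟩ (fun c'' => ?_) c'
    exact exists_valuation_apply_eq_zpow_three σ hσv hϖ hJ₀₂ hJ₁₁ (hφU _) (coe_apply_eq_diagonal_of_mem_centralizer w.1 _ hγ' hd (⟨τG, hτZ⟩ : Subgroup.centralizer _).2) hτ₀
      (hφU (c'' : «local» E c 3 J v)) (coe_apply_eq_diagonal_of_mem_centralizer w.1 _ hγ' hd c''.2)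
  · exact eq_zero_of_zpow_mem_compactCore_centralizer w.1 _ hγ' hd hφ ⟨τG, hτZ⟩ (i := 0)
      (by rw [hτ₀]; exact inv_ne_one.2 hϖ.valuation_lt_one.ne) n hn

end Carrier

/-! ## §3 (ED. 2) The generator with third slot `σ_w ϖ` at ANY non-split place — no `σ_w ϖ = ϖ` (the tame∕wild ramified reading; F0P2-p02 (g25), CENSUS «(G2)∕(G1)-RAM» v2 row (T2)-RAM, DEAL F0P3a-p09 (g13) 23:37:17Z) -/

section CarrierAnyPlace

open Literature.NumberTheory.GaloisRepresentations

variable {F E : Type} [Field F] [NumberField F] [Field E] [NumberField E] [Algebra F E] [Algebra.IsQuadraticExtension F E]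
  (c : E ≃ₐ[F] E) (J : Matrix (Fin 3) (Fin 3) E) {v : HeightOneSpectrum (𝓞 F)} (hc : c ≠ 1) (w : PlacesOver E v) (hw : c • w.1 = w.1)

/-- **THE SPLIT-TORUS GENERATOR ON THE CARRIER `U(J)(F_v)`, ANY NON-SPLIT `v` (inert or ramified), `J_w` antidiagonal-shaped of size 3.**  If the one-place image
`e γ ∈ U(σ_w, J_w)(E_w)` of `γ` is a REGULAR diagonal matrix, then for EVERY uniformizing `ϖ` of `E_w` (`𝒪_w` a DVR; no `σ_w ϖ = ϖ`) the element `τ := e⁻¹ diag(ϖ⁻¹, 1, σ_w ϖ)` lies in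
`Z(γ)` and satisfies (gen) `∀ c ∈ Z(γ), ∃ n, c·τ^{−n} ∈ compactCore Z(γ)` and (free) `τ^n ∈ compactCore Z(γ) → n = 0` — the hypotheses `hgen`, `hfree` of ★
`classOrbitalIntegral_indicator_complex_eq_mul_natCard_quotient_zpowers`, with `e τ = diagonal ![ϖ⁻¹, 1, σ_w ϖ]` the `hτm` binder of ★ `natCard_quotient_fixedBy_add_eq_natCard_quotient_fixedBy_inf_three_of_transitive`
∕ `…_of_neg` (P2-RAM).  Twin of ★ `exists_splitTorus_generator_local_of_nonsplit_three` (third slot `ϖ`, needs `σ_w ϖ = ϖ`): unitarity of `diag(ϖ⁻¹, 1, σ_w ϖ)` uses only `σ_w ∘ σ_w = id`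
(★ `galAdicCompletionMap_galAdicCompletionMap_of_smul_eq`); (gen)∕(free) read the entry `(0,0) = ϖ⁻¹` only. [cite: Tits1979, §1.2 pp. 31–32; §1.15 p. 40] [cite: Rogawski1990, §3.6 p. 28; §4.3 p. 43] [cite: Serre1980Trees, II.1.3] -/
theorem exists_splitTorus_generator_local_of_nonsplit_three_of_involution
    (hJ : ∀ i j : Fin 3, j ≠ Fin.rev i → placeForm J w.1 i j = 0) (hJ₀₂ : placeForm J w.1 0 2 ≠ 0) (hJ₁₁ : placeForm J w.1 1 1 ≠ 0)
    [IsDiscreteValuationRing 𝒪[w.1.adicCompletion E]] {ϖ : w.1.adicCompletion E} (hϖ : IsUniformizingElement ϖ)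
    {γ : «local» E c 3 J v} {d : Fin 3 → w.1.adicCompletion E}
    (hγ : (((localNonsplitEquiv c J hc w hw γ : unitaryGroupOfForm (galAdicCompletionMap (L := E) c hw) (placeForm J w.1)) :
      GL (Fin 3) (w.1.adicCompletion E)) : Matrix (Fin 3) (Fin 3) (w.1.adicCompletion E)) = diagonal d) (hd : ∀ i j, i ≠ j → IsUnit (d i - d j)) :
    ∃ τ : Subgroup.centralizer ({γ} : Set («local» E c 3 J v)),
      (((localNonsplitEquiv c J hc w hw (τ : «local» E c 3 J v) : unitaryGroupOfForm (galAdicCompletionMap (L := E) c hw) (placeForm J w.1)) :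
          GL (Fin 3) (w.1.adicCompletion E)) : Matrix (Fin 3) (Fin 3) (w.1.adicCompletion E)) = diagonal ![ϖ⁻¹, 1, galAdicCompletionMap (L := E) c hw ϖ] ∧
      (∀ c' : Subgroup.centralizer ({γ} : Set («local» E c 3 J v)), ∃ n : ℤ, c' * (τ ^ n)⁻¹ ∈ compactCore (Subgroup.centralizer ({γ} : Set («local» E c 3 J v)))) ∧
      (∀ n : ℤ, τ ^ n ∈ compactCore (Subgroup.centralizer ({γ} : Set («local» E c 3 J v))) → n = 0) := by
  set σ := galAdicCompletionMap (L := E) c hw with hσdef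
  set e := localNonsplitEquiv c J hc w hw with hedef
  have hσv : ∀ x : w.1.adicCompletion E, valuation (w.1.adicCompletion E) (σ x) = valuation (w.1.adicCompletion E) x :=
    fun x => valuation_galAdicCompletionMap_eq c v w hw x
  have hσσ : ∀ x : w.1.adicCompletion E, σ (σ x) = x := galAdicCompletionMap_galAdicCompletionMap_of_smul_eq c w hc hw
  have hϖ0 : ϖ ≠ 0 := hϖ.ne_zero
  -- the diagonal unitary `τ_U = diag(ϖ⁻¹, 1, σ ϖ)` — unitary for EVERY involution `σ`
  have ht : ∀ i, (![ϖ⁻¹, 1, σ ϖ] : Fin 3 → w.1.adicCompletion E) i ≠ 0 := by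
    intro i
    fin_cases i
    · exact inv_ne_zero hϖ0
    · exact one_ne_zero
    · exact (map_ne_zero σ).2 hϖ0
  set τU : GL (Fin 3) (w.1.adicCompletion E) := glDiagonal 3 (w.1.adicCompletion E) fun i => Units.mk0 ((![ϖ⁻¹, 1, σ ϖ] : Fin 3 → w.1.adicCompletion E) i) (ht i)
    with hτUdef
  have hτUt : (τU : Matrix (Fin 3) (Fin 3) (w.1.adicCompletion E)) = diagonal ![ϖ⁻¹, 1, σ ϖ] := by rw [hτUdef, coe_glDiagonal]; rfl
  have hτUmem : τU ∈ unitaryGroupOfForm σ (placeForm J w.1) := by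
    refine mem_unitaryGroupOfForm_of_eq_diagonal_three σ hJ hτUt ?_ ?_ ?_
    · show σ ϖ⁻¹ * σ ϖ = 1
      rw [← map_mul, inv_mul_cancel₀ hϖ0, map_one]
    · show σ 1 * 1 = 1
      rw [map_one, mul_one]
    · show σ (σ ϖ) * ϖ⁻¹ = 1
      rw [hσσ, mul_inv_cancel₀ hϖ0]
  -- pull it back to the carrier (★'s argument, verbatim)
  set τG : «local» E c 3 J v := e.symm ⟨τU, hτUmem⟩ with hτGdef
  have heτ : e τG = ⟨τU, hτUmem⟩ := e.apply_symm_apply _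
  have hτZ : τG ∈ Subgroup.centralizer ({γ} : Set («local» E c 3 J v)) := by
    rw [Subgroup.mem_centralizer_singleton_iff]
    apply e.injective
    rw [map_mul, map_mul, heτ]
    apply Subtype.ext
    apply Units.ext
    change (τU : Matrix (Fin 3) (Fin 3) (w.1.adicCompletion E)) * ((e γ : unitaryGroupOfForm σ (placeForm J w.1)) : GL (Fin 3) (w.1.adicCompletion E)) =
      (((e γ : unitaryGroupOfForm σ (placeForm J w.1)) : GL (Fin 3) (w.1.adicCompletion E)) : Matrix (Fin 3) (Fin 3) (w.1.adicCompletion E)) * τU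
    rw [hτUt, hγ, diagonal_mul_diagonal, diagonal_mul_diagonal]
    congr 1
    funext i
    exact mul_comm _ _
  -- the closed embedding `φ = subtype ∘ e`
  have hφ := isClosedEmbedding_subtype_comp_localNonsplitEquiv c 3 J hc w hw
  have hφU : ∀ g : «local» E c 3 J v,
      ((unitaryGroupOfForm σ (placeForm J w.1)).subtype.comp e.toMonoidHom) g ∈ unitaryGroupOfForm σ (placeForm J w.1) := fun g => (e g).2
  have hγ' : ((((unitaryGroupOfForm σ (placeForm J w.1)).subtype.comp e.toMonoidHom) γ : GL (Fin 3) (w.1.adicCompletion E)) :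
      Matrix (Fin 3) (Fin 3) (w.1.adicCompletion E)) = diagonal d := hγ
  have hτ₀ : valuation (w.1.adicCompletion E) (((((unitaryGroupOfForm σ (placeForm J w.1)).subtype.comp e.toMonoidHom)
      ((⟨τG, hτZ⟩ : Subgroup.centralizer ({γ} : Set («local» E c 3 J v))) : «local» E c 3 J v) : GL (Fin 3) (w.1.adicCompletion E)) :
        Matrix (Fin 3) (Fin 3) (w.1.adicCompletion E)) 0 0) = (valuation (w.1.adicCompletion E) ϖ)⁻¹ := by
    change valuation (w.1.adicCompletion E) ((((e τG : unitaryGroupOfForm σ (placeForm J w.1)) : GL (Fin 3) (w.1.adicCompletion E)) :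
      Matrix (Fin 3) (Fin 3) (w.1.adicCompletion E)) 0 0) = (valuation (w.1.adicCompletion E) ϖ)⁻¹
    rw [heτ]
    change valuation (w.1.adicCompletion E) ((τU : Matrix (Fin 3) (Fin 3) (w.1.adicCompletion E)) 0 0) = (valuation (w.1.adicCompletion E) ϖ)⁻¹
    rw [hτUt, diagonal_apply_eq]
    exact map_inv₀ _ _
  refine ⟨⟨τG, hτZ⟩, ?_, fun c' => ?_, fun n hn => ?_⟩
  · change (((e τG : unitaryGroupOfForm σ (placeForm J w.1)) : GL (Fin 3) (w.1.adicCompletion E)) : Matrix (Fin 3) (Fin 3) (w.1.adicCompletion E)) =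
      diagonal ![ϖ⁻¹, 1, σ ϖ]
    rw [heτ]
    exact hτUt
  · refine exists_mul_zpow_inv_mem_compactCore_centralizer w.1 _ hγ' hd hφ ⟨τG, hτZ⟩ (fun c'' => ?_) c'
    exact exists_valuation_apply_eq_zpow_three σ hσv hϖ hJ₀₂ hJ₁₁ (hφU _) (coe_apply_eq_diagonal_of_mem_centralizer w.1 _ hγ' hd (⟨τG, hτZ⟩ : Subgroup.centralizer _).2) hτ₀
      (hφU (c'' : «local» E c 3 J v)) (coe_apply_eq_diagonal_of_mem_centralizer w.1 _ hγ' hd c''.2)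
  · exact eq_zero_of_zpow_mem_compactCore_centralizer w.1 _ hγ' hd hφ ⟨τG, hτZ⟩ (i := 0)
      (by rw [hτ₀]; exact inv_ne_one.2 hϖ.valuation_lt_one.ne) n hn

end CarrierAnyPlace

end Literature.NumberTheory.Automorphic.UnitaryGroup

end
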